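import Literature.MathematicalPhysics.QuantumFieldTheory.Balaban1983to89.Node00.TkOfRecord
import Literature.MathematicalPhysics.QuantumFieldTheory.Balaban1983to89.Node00.StepWeightsOfRecord
import Literature.MathematicalPhysics.QuantumFieldTheory.Balaban1983to89.Node00.LargeFieldBackgroundOfRecord

/-!
# NODE 00 — DEFINER ₇b (T-side), FILE 12a: the 𝐓-WEIGHTS OF RECORD — the residual weight datum `TkWeights` of 11a
# (`Node00.TkOfRecord`) PINNED where print pins it: the fluctuation-field characteristic functions (3.16)∕(3.21) [III]
# on the χ_{j+1}-cubes, the approximate-fluctuation functions (3.3) localized in `S_{j+1}`, and the p. 256 regularity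
# function of the retained variables as an explicit factor of `ζ_j`; the rest stays a SMALLER residual with displayed laws

Cell `pub-ymgap`, NODE 00, definer seat ₇b∕₉∕₁₀∕₁₁ (`pub-ymgap-node00-def-T`, g4).  [III] = [Balaban1988Convergent] (CMP **119** (1988)
243–285; journal page = PDF page + 242, renders `…-p022-x2.png` – `…-p028-x2.png` = pp. 264–270 of
`run/shared/lean/pub/pub-balaban/b2b-balaban-ref1/pages/1988-cmp119-convergent-renormalization/`), [I] = [Balaban1987RG1].

WHY THIS FILE (invariant I3 of the cell, plan [YMPLAN-G60-VACUITY-CHAIN-ANSWER]: *no field an item reads may stay free*).  11a typed the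
multi-scale operation `𝐓_k` of (2.18)–(2.22) over a RESIDUAL weight datum `TkWeights F N V K = {ζ, quad, chiA}` (region-indexed functions of the
all-scales configuration `MultiCfg`), and 11d's record `IsRecordOfRecord₁₁C` carries it as the free parameter `Stage11Params.Wt`.  Print PINS two of
the three fields up to named analytic objects, and this file types exactly that, over the tree's own (3.2)∕(3.3)∕(3.16) objects (r11's
`B14.Sect3Decomp`, `B14.Eq316`; n02-b's cube families and thresholds of `Node00.StepWeightsOfRecord`; def-R's regularity predicate of
`Node00.LargeFieldBackgroundOfRecord`):
* §1 THE χ_{j+1}-CUBE DATA OF GENERATION `j`, SEQUENCE-FREE: the bond sets `(□′^{∼2})^{(j)*}` (`bondsStarW`), the one-cube backgrounds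
  `U_{j+1,□′}(V_{j+1})` of (2.16)∕(3.2) (`ukLocW` = def-R's `ukBox` one level up, verbatim n02-b's `sect3DataOfRecord` fields, which read the old
  sequence `s` only through the (3.3)-window `inB` — not needed here: `sect3DataW` with `inB := id`, faces `sect3DataW_bondsStar∕_UkLoc∕_plaqT`
  `rfl` against n02-b's value); the threshold `δ_j = g_j A₁∕(A₀p₀(g_j))` of (3.4) is n02-b's `deltaOfRecord` BY NAME.
* §2 THE FACTORS, as functions of the all-scales configuration `ω` (generation `j` reads `A_j = (ω j).2`, `V_j = (ω j).1`, `V_{j+1} = (ω (j+1)).1`):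
  `chiSmallAW` = `χ^{(j)}(X)` and `chiLargeAW` = `χ^{(j)c}(X)` of (3.16) p. 268 (r11's `chiK`∕`chiKc` at `A_j`, `δ_j`), `chiPrimeW` = `χ′_j(X)` of (3.3)
  p. 265 (r11's `chiPrime` on `sect3DataW` with the averaging of record `avOfRecord`, threshold `2δ_j`), and `chiRegW cR j Y` = the characteristic
  function of p. 256's regularity of the retained scale-`j` variables on `Y` (*«we assume that the field V_{j−1} is regular on Γ_{j−1} in the sense that
  |∂V_{j−1} − 1| < O(L²)ε_{j−1}»*): `PlaqSmallOn (plaqsOf (pts j Y)) (cR·ε_j) (ω j).1` — def-R's predicate of `regSuppOfRecord` (FILE 13) at ONE scale,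
  with the same letter `cR` and the same `ε_j = epsOfRecord ν g j`.
* §3 THE SMALLER RESIDUAL `TkResidualW F N V K = {ζ0, quad}` with the law `ζ0 ≥ 0`: `ζ0 j Y` = what remains of `ζ_j(Y)` after the regularity factor —
  the resummation over `(P_{j+1}, Q_{j+1})` of the (3.2)·(3.3) characteristic functions determining `Ω_{j+1}` and the axial gauge-fixing terms (p. 267:
  *«a function ζ(Ω^c_{k+1}) which is a sum of products of characteristic functions and the functions connected with gauge fixing terms»*) — it reads the
  WHOLE old sequence `{Ω_i}_{i≤j+1}` through the windows of (3.2)∕(3.3) (n02-b's `aWeight`·`bWeight`, sequence-indexed), which the `(j, Y)`-indexed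
  signature of 11a's `TkWeights.ζ` does not carry: LOCATED, left residual; `quad j Λ′` = `⟨A_j, 𝒬_j(Λ′)A_j⟩` of (2.21)∕(3.23) ([I]'s `C`, `Δ^{(j)}`,
  `C^{(j)}(Λ′)`: `B12Eq15QuadraticForm`-shaped objects, not constructed in the tree) — residual, as in 11a.
* §4 **THE 𝐓-WEIGHTS OF RECORD** `tkWeightsOfRecord F N V ν A₁ cR p g Z : TkWeights F N V p.K`:
  `ζ j Y := ζ0 j Y · chiRegW cR j Y`;  `quad := Z.quad`;
  `chiA j Y S := 𝟙[S ⊆ Y] · χ^{(j)}(χ_{j+1}-cubes ⊂ Y∖S) · χ^{(j)c}(χ_{j+1}-cubes ⊂ S) · χ′_j(χ_{j+1}-cubes ⊂ S)` — (3.21) p. 269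
  *«χ(Ω_{k+1}∩Λᶜ_{k+1}, S_{k+1}) = χ^{(k)}(Rᶜ_{k+1}∩Λᶜ_{k+1}) χ^{(k)c}(R_{k+1}) χ′_k(S_{k+1})»* with `Y = Ω_{j+1}∩Λᶜ_{j+1}` and `R_{j+1}` = the
  χ_{j+1}-cubes of `S_{j+1}` ((3.20): `S_{k+1} = (Ω_{k+1}∖Ω^{∼−1}_{k+1}) ∪ R_{k+1}`, the layer `Ω∖Ω^{∼−1}` being ONE `LMR_{k+1}`-layer (p. 268), which
  in the tree's nested-partition reading contains no χ-cube: the χ_{j+1}-cubes inside `S` are exactly those of `R`); and `tkWeightsOfRecord_laws`: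
  11a's `TkWeights.Laws` HOLD at the weights of record under `Z.Laws` (every pinned factor is `{0,1}`-valued — PROVED).
* §5 SUPPORT READINGS (the point of the pin; all PROVED, by unfolding): `zetaWt_ne_zero` (a non-zero `ζ_j(Y)` of record forces p. 256's regularity of
  `(ω j).1` on `plaqsOf (pts j Y)`), `genSet_subset_pts_compl` + **`plaqSmallOn_genSet_of_zeta_ne_zero`** — THE T-HALF OF THE JOINT STATEMENT def-R
  located ([RFACE-11d], pub-ymgap INBOX l.11875: *«supp χ_n ⊆ regSupp is a JOINT (χ_n, Wt) statement typable once weights are pinned»*): at `Y = Ω^c_{j+1}`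
  and `j < n` the non-vanishing of the generation-`j` weight gives def-R's `regSuppOfRecord` clause AT SCALE `j` for `W j := (ω j).1` verbatim
  (`PlaqSmallOn (plaqsOf (genSet Ω n j)) (cR·ε_j) (ω j).1`; the top scale `j = n` is the density's own argument, restricted by def-R's front factor
  `χ_n(Ω_n)` of (2.17), not by a 𝐓-generation); `chiAW_ne_zero` (a non-zero `χ(Y,S)` of record forces `S ⊆ Y`, `|A_j(b)| < δ_j` on the bonds of every
  χ_{j+1}-cube inside `Y∖S`, and on every χ_{j+1}-cube inside `S` a bond with `|A_j(b)| ≥ δ_j` together with the (3.3) condition); the located junk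
  corner of the letters (`cR·ε_j ≤ 0` ⇒ `chiRegW` does not read `ω`, cf. def-R's `plaqSmallOn_iff_of_nonpos`).

LOCATED SIMPLIFICATIONS (said; each is a typing decision print does not make, none asserts anything):
(i) (3.16) is printed *«on the domain Ω^{∼−1}_{k+1}»*; the `(j, Y, S)`-indexed signature of `TkWeights.chiA` does not determine `Ω_{j+1}` (`Y = Ω_{j+1}∖Λ_{j+1}`),
so the small-fluctuation factor is typed on EVERY χ_{j+1}-cube inside `Y∖S` — print's plus those of the outermost `LMR_{j+1}`-collar of `Ω_{j+1}` that
lie in `Y∖S` (an extra restriction there; a `(Ω, Λ, S)`-indexed weight datum is a signature change of 11a = a successor, not an in-place edit).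
(ii) `χ′_j(S)` is typed through (3.3) VERBATIM at `(V_j, V_{j+1}) = ((ω j).1, (ω (j+1)).1)` with `V^{(j)}_{□′} = M^j(U_{j+1,□′})` ((3.4); r11's `Vbox`);
print's final form reads it after the changes of variables of p. 269 (*«the same function but with V^{(k)} replaced by V^{(k)}_{Λᶜ_{k+1}∩Λ_k}»*, (3.22),
and (1.22) on `(R^{∼2}_{k+1}∩S_{k+1})^{(k)*}`) — NOT applied (r11's `B14.Eq316.bH` ∕ `B14.ChangeOfVariables.newVar` are the typed ingredients; successor).
(iii) `𝟙[S ⊆ Y]` is the only admissibility clause carried ((2.1) *«S_j ⊂ Ω_j ∩ Λ^c_j»*); the layer clause *«it contains Ω_j∖Ω_j^{∼−1}»* is not imposed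
(11a's index `admSOfRecord` ranges over unions of χ-cubes, which never contain that `LMR`-layer in the nested reading — 11a header, located).
(iv) The weights depend on the run `p` and the coupling history `g` (through `δ_j`, `ε_j`, the cube sides `R_{j+1}(g_{j+1})`); 11d's binder
`Stage11Params.Wt : (K : ℕ) → TkWeights … K` is coarser (per torus) — the Stage-12 record (12b, successor file) binds the weights per run at
`g := gOfRecord₁₀ θ p`, drops `Wt`, and carries `0 < cR` (ref-D WATCH-11d-CR; def-R `one_mem_regSuppOfRecord`).

HONEST SCOPE.  Definitions of record + `{0,1}`-bookkeeping; every face is PROVED by unfolding (`Finset.prod_eq_zero_iff`, r11's `chiK_eq_one_iff` ∕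
`chiPrime_eq_one_iff`, def-R's `plaqsOf_mono`).  NOT ASSERTED: anything of Bałaban — Theorem 2 [III], (3.6)–(3.9), (3.12)–(3.19), the bounds on `ζ`, the
positivity of `𝒬_j`, [14]∕[15]; no positivity of `cR`, `A₁`, `δ_j` assumed (their junk corners are located in §5).  Counts UNMOVED (typed 28∕28 ·
discharged 5∕28); one finite `T⁴` torus at fixed `ε = L^{−K}`; not continuum ∕ ℝ⁴ ∕ OS ∕ mass-gap ∕ Clay.  No `sorry`, no `axiom`, no `instance`, no `notation`.
-/

noncomputable section

open MeasureTheory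
open scoped BigOperators

namespace Literature.MathematicalPhysics.QuantumFieldTheory.Balaban1983to89.Node00

open T4NestedCovariance T4AdjointCovariance T4AveragingDisintegration T4Continuum T4FiniteEpsInhabited
open B15DeterminingSets B14.Eq213DetSet B14.Eq216Concrete B14.Eq213MaximalDomains B15Eq112TorusCover B14DomainGeom
open B14.Sect3Decomp B14.Eq316 B14.Eq218Concrete B10Eq42TorusConstraint B8Eq17ClassAkV1
open Tk

/-! ## §1  The χ_{j+1}-cube data of generation `j`, sequence-free -/

section CubeData

variable (F : T4Family) (N : ℕ) [NeZero N] (ν : Stage7Numerics) (p : B12.RunParams) (g : ℕ → ℝ) (j : ℕ)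

open Classical in
/-- `(□′^{∼2})^{(j)*}`: the level-`j` bonds with both ends in the two-layer enlargement of the χ_{j+1}-cube `□′` (r12's `embIter`; verbatim the
`bondsStar` field of n02-b's `sect3DataOfRecord`). [cite: Balaban1988Convergent, (3.3) p.265, (3.16) p.268] -/
def bondsStarW (c : Iχ F ν p g j) : Finset (PBond (F.P p.K) j) :=
  Finset.univ.filter (fun b : PBond (F.P p.K) j =>
    embIter j b.src ∈ cubeEnl (F.P p.K) (sideχ F ν p g j) c 2 ∧ embIter j b.tgt ∈ cubeEnl (F.P p.K) (sideχ F ν p g j) c 2)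

/-- `U_{j+1,□′}(V_{j+1})`: def-R's (2.16) one-cube background `ukBox` one level up on `□′^{∼4}` with the (2.12) datum `bgOfRecord` (verbatim the `UkLoc`
field of n02-b's `sect3DataOfRecord`). [cite: Balaban1988Convergent, (2.16) p.257, (3.2) p.265] -/
def ukLocW (c : Iχ F ν p g j) (V' : GaugeField (F.P p.K) (j + 1) (SU N)) : GaugeField (F.P p.K) 0 (SU N) :=
  ukBox (bgOfRecord (avOfRecord F N p.K) {U | PlaqSmall (ν.εreg * (F.P p.K).eta (j + 1) ^ 2) U}) ν.M₁
    (cubeEnl (F.P p.K) (sideχ F ν p g j) c 4) (j + 1) V'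

open Classical in
/-- **THE (3.2)∕(3.3)∕(3.4) DATA OF GENERATION `j`, SEQUENCE-FREE** (a value of r11's `Sect3Data`): cubes = the χ_{j+1}-indices, `{p ⊂ □′^∼}`,
`(□′^{∼2})^{(j)*}`, `U_{j+1,□′}`; the (3.3)-window `inB` (the only sequence-dependent field of n02-b's value) is NOT read by the factors of this file
and is set to the identity. [cite: Balaban1988Convergent, (3.2)–(3.4) p.265] -/
def sect3DataW : Sect3Data (F.P p.K) (SU N) j where
  Cube1 := Iχ F ν p g j
  plaqT c := plaqInside (cubeEnl (F.P p.K) (sideχ F ν p g j) c 1)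
  bondsStar := bondsStarW F ν p g j
  inB Pl := Pl
  UkLoc := ukLocW F N ν p g j

/-- The cube type of the sequence-free data is the χ_{j+1}-index type (`rfl`). [cite: Balaban1988Convergent, (3.2) p.265 (bookkeeping)] -/
theorem sect3DataW_Cube1 : (sect3DataW F N ν p g j).Cube1 = Iχ F ν p g j := rfl

/-- The bond sets agree with n02-b's sequence-indexed value (`rfl`). [cite: Balaban1988Convergent, (3.3) p.265 (bookkeeping)] -/
theorem sect3DataW_bondsStar (M : ℕ) (s : SeqOfRecord F ν M g p.K j) :
    (sect3DataW F N ν p g j).bondsStar = (sect3DataOfRecord F N ν M p g j s).bondsStar := rfl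

/-- The one-cube backgrounds agree with n02-b's sequence-indexed value (`rfl`). [cite: Balaban1988Convergent, (3.2) p.265 (bookkeeping)] -/
theorem sect3DataW_UkLoc (M : ℕ) (s : SeqOfRecord F ν M g p.K j) :
    (sect3DataW F N ν p g j).UkLoc = (sect3DataOfRecord F N ν M p g j s).UkLoc := rfl

/-- The plaquette families agree with n02-b's sequence-indexed value (`rfl`). [cite: Balaban1988Convergent, (3.2) p.265 (bookkeeping)] -/
theorem sect3DataW_plaqT (M : ℕ) (s : SeqOfRecord F ν M g p.K j) :
    (sect3DataW F N ν p g j).plaqT = (sect3DataOfRecord F N ν M p g j s).plaqT := rfl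

end CubeData

/-! ## §2  The pinned factors as functions of the all-scales configuration -/

section AFactors

variable (F : T4Family) (N : ℕ) (V : Type) [SeminormedAddCommGroup V]
variable (ν : Stage7Numerics) (A₁ : ℝ) (p : B12.RunParams) (g : ℕ → ℝ) (j : ℕ)

/-- `χ^{(j)}(X)(A_j) = Π_{□′∈X} χ({sup_{b∈(□′^{∼2})^{(j)*}} |A_j(b)| < δ_j})` of (3.16), read at the generation-`j` fluctuation variables `(ω j).2`
(r11's `chiK`; `δ_j` = n02-b's `deltaOfRecord`). [cite: Balaban1988Convergent, (3.16) p.268, (3.4) p.265] -/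
def chiSmallAW (X : Finset (Iχ F ν p g j)) (ω : MultiCfg (F.P p.K) (SU N) V) : ℝ :=
  chiK (bondsStarW F ν p g j) (ω j).2 (deltaOfRecord ν g j A₁) X

/-- `χ^{(j)c}(X)(A_j) = Π_{□′∈X} χ({sup_{b∈(□′^{∼2})^{(j)*}} |A_j(b)| ≥ δ_j})` of (3.16) (r11's `chiKc`). [cite: Balaban1988Convergent, (3.16) p.268] -/
def chiLargeAW (X : Finset (Iχ F ν p g j)) (ω : MultiCfg (F.P p.K) (SU N) V) : ℝ :=
  chiKc (bondsStarW F ν p g j) (ω j).2 (deltaOfRecord ν g j A₁) X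

variable {F N V ν A₁ p g j}

/-- `χ^{(j)}(X) ∈ {0, 1}`: it is `1` iff every cube of `X` is small-field, else `0`. [cite: Balaban1988Convergent, (3.16) p.268 (bookkeeping)] -/
theorem chiSmallAW_eq_ite (X : Finset (Iχ F ν p g j)) (ω : MultiCfg (F.P p.K) (SU N) V)
    [Decidable (∀ c ∈ X, SmallFluct (bondsStarW F ν p g j) (ω j).2 (deltaOfRecord ν g j A₁) c)] :
    chiSmallAW F N V ν A₁ p g j X ω =
      if ∀ c ∈ X, SmallFluct (bondsStarW F ν p g j) (ω j).2 (deltaOfRecord ν g j A₁) c then 1 else 0 := by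
  unfold chiSmallAW chiK
  split_ifs with h
  · exact Finset.prod_eq_one fun c hc => if_pos (h c hc)
  · push Not at h
    obtain ⟨c, hc, hnc⟩ := h
    exact Finset.prod_eq_zero hc (if_neg hnc)

/-- `χ^{(j)c}(X) ∈ {0, 1}`: it is `1` iff NO cube of `X` is small-field, else `0`. [cite: Balaban1988Convergent, (3.16) p.268 (bookkeeping)] -/
theorem chiLargeAW_eq_ite (X : Finset (Iχ F ν p g j)) (ω : MultiCfg (F.P p.K) (SU N) V)
    [Decidable (∀ c ∈ X, ¬ SmallFluct (bondsStarW F ν p g j) (ω j).2 (deltaOfRecord ν g j A₁) c)] :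
    chiLargeAW F N V ν A₁ p g j X ω =
      if ∀ c ∈ X, ¬ SmallFluct (bondsStarW F ν p g j) (ω j).2 (deltaOfRecord ν g j A₁) c then 1 else 0 := by
  unfold chiLargeAW chiKc
  split_ifs with h
  · exact Finset.prod_eq_one fun c hc => if_neg (h c hc)
  · push Not at h
    obtain ⟨c, hc, hnc⟩ := h
    exact Finset.prod_eq_zero hc (if_pos hnc)

/-- `0 ≤ χ^{(j)}(X)`. [cite: Balaban1988Convergent, (3.16) p.268 (bookkeeping)] -/
theorem chiSmallAW_nonneg (X : Finset (Iχ F ν p g j)) (ω : MultiCfg (F.P p.K) (SU N) V) : 0 ≤ chiSmallAW F N V ν A₁ p g j X ω := by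
  classical
  rw [chiSmallAW_eq_ite]; split_ifs <;> norm_num

/-- `χ^{(j)}(X) ≤ 1`. [cite: Balaban1988Convergent, (3.16) p.268 (bookkeeping)] -/
theorem chiSmallAW_le_one (X : Finset (Iχ F ν p g j)) (ω : MultiCfg (F.P p.K) (SU N) V) : chiSmallAW F N V ν A₁ p g j X ω ≤ 1 := by
  classical
  rw [chiSmallAW_eq_ite]; split_ifs <;> norm_num

/-- `0 ≤ χ^{(j)c}(X)`. [cite: Balaban1988Convergent, (3.16) p.268 (bookkeeping)] -/
theorem chiLargeAW_nonneg (X : Finset (Iχ F ν p g j)) (ω : MultiCfg (F.P p.K) (SU N) V) : 0 ≤ chiLargeAW F N V ν A₁ p g j X ω := by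
  classical
  rw [chiLargeAW_eq_ite]; split_ifs <;> norm_num

/-- `χ^{(j)c}(X) ≤ 1`. [cite: Balaban1988Convergent, (3.16) p.268 (bookkeeping)] -/
theorem chiLargeAW_le_one (X : Finset (Iχ F ν p g j)) (ω : MultiCfg (F.P p.K) (SU N) V) : chiLargeAW F N V ν A₁ p g j X ω ≤ 1 := by
  classical
  rw [chiLargeAW_eq_ite]; split_ifs <;> norm_num

end AFactors

section VFactors

variable (F : T4Family) (N : ℕ) [NeZero N] (V : Type)
variable (ν : Stage7Numerics) (A₁ cR : ℝ) (p : B12.RunParams) (g : ℕ → ℝ) (j : ℕ)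

/-- `χ′_j(X)(V_j, V_{j+1}) = Π_{□′∈X} χ({sup_{b∈(□′^{∼2})^{(j)*}} |V_j(b)(V^{(j)}_{□′}(b))⁻¹ − 1| < 2δ_j})` of (3.3), `V^{(j)}_{□′} = M^j(U_{j+1,□′})` (3.4),
read at `((ω j).1, (ω (j+1)).1)` with the averaging of record (r11's `chiPrime` on `sect3DataW`; located simplification (ii) of the header).
[cite: Balaban1988Convergent, (3.3)–(3.4) p.265, (3.21) p.269] -/
def chiPrimeW (X : Finset (Iχ F ν p g j)) (ω : MultiCfg (F.P p.K) (SU N) V) : ℝ :=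
  chiPrime (sect3DataW F N ν p g j) (avOfRecord F N p.K) (2 * deltaOfRecord ν g j A₁) X (ω j).1 (ω (j + 1)).1

open Classical in
/-- **THE p. 256 REGULARITY FUNCTION of the retained scale-`j` variables on the region `Y`**: `1` if `|(ω j).1(∂p) − 1| < cR·ε_j` for every plaquette
of `T^{(j)}` touching `Y^{(j)}`, else `0` — def-R's `regSuppOfRecord` predicate (FILE 13) at one scale, same letter `cR`, same `ε_j`.
[cite: Balaban1988Convergent, (2.10) p.256, (2.28) p.259] -/
def chiRegW (Y : Set (Site (F.P p.K) 0)) (ω : MultiCfg (F.P p.K) (SU N) V) : ℝ :=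
  if PlaqSmallOn (plaqsOf (pts j Y)) (cR * epsOfRecord ν g j) (ω j).1 then 1 else 0

variable {F N V ν A₁ cR p g j}

/-- `χ′_j(X) ∈ {0, 1}`: it is `1` iff every cube of `X` satisfies the (3.3) condition, else `0`. [cite: Balaban1988Convergent, (3.3) p.265 (bookkeeping)] -/
theorem chiPrimeW_eq_ite (X : Finset (Iχ F ν p g j)) (ω : MultiCfg (F.P p.K) (SU N) V)
    [Decidable (∀ c ∈ X, SmallApproxFluct (sect3DataW F N ν p g j) (avOfRecord F N p.K) (2 * deltaOfRecord ν g j A₁) (ω j).1 (ω (j + 1)).1 c)] :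
    chiPrimeW F N V ν A₁ p g j X ω =
      if ∀ c ∈ X, SmallApproxFluct (sect3DataW F N ν p g j) (avOfRecord F N p.K) (2 * deltaOfRecord ν g j A₁) (ω j).1 (ω (j + 1)).1 c
      then 1 else 0 := by
  classical
  unfold chiPrimeW chiPrime
  split_ifs with h
  · exact Finset.prod_eq_one fun c hc => if_pos (h c hc)
  · push Not at h
    obtain ⟨c, hc, hnc⟩ := h
    exact Finset.prod_eq_zero hc (if_neg hnc)

/-- `0 ≤ χ′_j(X)`. [cite: Balaban1988Convergent, (3.3) p.265 (bookkeeping)] -/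
theorem chiPrimeW_nonneg (X : Finset (Iχ F ν p g j)) (ω : MultiCfg (F.P p.K) (SU N) V) : 0 ≤ chiPrimeW F N V ν A₁ p g j X ω := by
  classical
  rw [chiPrimeW_eq_ite]; split_ifs <;> norm_num

/-- `χ′_j(X) ≤ 1`. [cite: Balaban1988Convergent, (3.3) p.265 (bookkeeping)] -/
theorem chiPrimeW_le_one (X : Finset (Iχ F ν p g j)) (ω : MultiCfg (F.P p.K) (SU N) V) : chiPrimeW F N V ν A₁ p g j X ω ≤ 1 := by
  classical
  rw [chiPrimeW_eq_ite]; split_ifs <;> norm_num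

/-- The regularity function takes the values `0`, `1`: `0 ≤ χ_reg`. [cite: Balaban1988Convergent, (2.10) p.256 (bookkeeping)] -/
theorem chiRegW_nonneg (Y : Set (Site (F.P p.K) 0)) (ω : MultiCfg (F.P p.K) (SU N) V) : 0 ≤ chiRegW F N V ν cR p g j Y ω := by
  unfold chiRegW; split_ifs <;> norm_num

/-- … and `χ_reg ≤ 1`. [cite: Balaban1988Convergent, (2.10) p.256 (bookkeeping)] -/
theorem chiRegW_le_one (Y : Set (Site (F.P p.K) 0)) (ω : MultiCfg (F.P p.K) (SU N) V) : chiRegW F N V ν cR p g j Y ω ≤ 1 := by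
  unfold chiRegW; split_ifs <;> norm_num

/-- **Support reading of the regularity function**: it is non-zero iff the retained scale-`j` variables are regular on `Y` in p. 256's sense
(def-R's predicate). [cite: Balaban1988Convergent, (2.10) p.256] -/
theorem chiRegW_ne_zero_iff (Y : Set (Site (F.P p.K) 0)) (ω : MultiCfg (F.P p.K) (SU N) V) :
    chiRegW F N V ν cR p g j Y ω ≠ 0 ↔ PlaqSmallOn (plaqsOf (pts j Y)) (cR * epsOfRecord ν g j) (ω j).1 := by
  unfold chiRegW; split_ifs with h <;> simp [h]

/-- THE LOCATED JUNK CORNER OF THE LETTER `cR` at one scale: for `cR·ε_j ≤ 0` the regularity function does not read `ω` — it is `1` iff no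
plaquette of `T^{(j)}` touches `Y^{(j)}` (def-R's `plaqSmallOn_iff_of_nonpos`).  Print's «O(L²)» is positive; the Stage-12 record carries `0 < cR`.
[cite: Balaban1988Convergent, (2.10) p.256 (bookkeeping)] -/
theorem chiRegW_ne_zero_iff_of_nonpos (hc : cR * epsOfRecord ν g j ≤ 0) (Y : Set (Site (F.P p.K) 0)) (ω : MultiCfg (F.P p.K) (SU N) V) :
    chiRegW F N V ν cR p g j Y ω ≠ 0 ↔ ∀ q, q ∉ plaqsOf (pts j Y) := by
  rw [chiRegW_ne_zero_iff, plaqSmallOn_iff_of_nonpos _ hc]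

end VFactors

/-! ## §3  The smaller residual: the sequence-resummed part of `ζ_j` and [I]'s quadratic form -/

section Residual

variable (F : T4Family) (N : ℕ) (V : Type)

/-- **THE RESIDUAL PART OF THE 𝐓-WEIGHTS after the pin**: `ζ0 j Y` = the factor of `ζ_j(Y)` other than the p. 256 regularity function (the resummation
over `(P_{j+1}, Q_{j+1})` of the (3.2)·(3.3) characteristic functions determining `Ω_{j+1}` and the axial gauge-fixing terms, p. 267 — sequence-indexed in
print, hence not expressible in the `(j, Y)`-indexed signature: located, header §3); `quad j Λ′` = `⟨A_j, 𝒬_j(Λ′) A_j⟩` of (2.21)∕(3.23) ([I]'s operators,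
not constructed in the tree). [cite: Balaban1988Convergent, (2.21) p.258, p.267, (3.23) p.270] -/
structure TkResidualW (K : ℕ) where
  ζ0 : ℕ → Set (Site (F.P K) 0) → MultiCfg (F.P K) (SU N) V → ℝ
  quad : ℕ → Set (Site (F.P K) 0) → MultiCfg (F.P K) (SU N) V → ℝ

variable {F N V} in
/-- THE DISPLAYED LAW of the residual part: `ζ0 ≥ 0` (a sum of products of characteristic functions and gauge-fixing δ-type factors is nonnegative;
nothing of [I]'s estimates). [cite: Balaban1988Convergent, p.267] -/
structure TkResidualW.Laws {K : ℕ} (Z : TkResidualW F N V K) : Prop where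
  zeta0_nonneg : ∀ j Y ω, 0 ≤ Z.ζ0 j Y ω

variable {F N V} in
/-- The laws are inhabited at the unit residual `ζ0 := 1`, `quad := 0` (range witness for consumers displaying `TkResidualW.Laws`; not print's functions).
[cite: Balaban1988Convergent, (2.21) p.258 (bookkeeping)] -/
theorem TkResidualW.laws_one (K : ℕ) : (⟨fun _ _ _ => 1, fun _ _ _ => 0⟩ : TkResidualW F N V K).Laws :=
  ⟨fun _ _ _ => zero_le_one⟩

end Residual

/-! ## §4  The 𝐓-weights of record -/

section Weights

variable (F : T4Family) (N : ℕ) [NeZero N] (V : Type) [SeminormedAddCommGroup V]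
variable (ν : Stage7Numerics) (A₁ cR : ℝ) (p : B12.RunParams) (g : ℕ → ℝ)

/-- `ζ_j(Y)` OF RECORD: the residual part times the p. 256 regularity function of the retained scale-`j` variables on `Y` (`Y = Ω^c_{j+1}` in 11a's
`genDataOfRecord`). [cite: Balaban1988Convergent, (2.21) p.258, (2.10) p.256, p.267] -/
def zetaWt (Z : TkResidualW F N V p.K) (j : ℕ) (Y : Set (Site (F.P p.K) 0)) (ω : MultiCfg (F.P p.K) (SU N) V) : ℝ :=
  Z.ζ0 j Y ω * chiRegW F N V ν cR p g j Y ω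

open Classical in
/-- **`χ(Y, S)` OF RECORD**, (3.21) on the χ_{j+1}-cubes: `𝟙[S ⊆ Y] · χ^{(j)}(cubes ⊂ Y∖S) · χ^{(j)c}(cubes ⊂ S) · χ′_j(cubes ⊂ S)`
(`Y = Ω_{j+1} ∩ Λ^c_{j+1}`, `S = S_{j+1}`, the χ_{j+1}-cubes of `S` = print's `R_{j+1}`; located simplifications (i)–(iii) of the header).
[cite: Balaban1988Convergent, (3.21) p.269, (3.16) p.268, (3.20) p.269, (2.1) p.254] -/
def chiAW (j : ℕ) (Y S : Set (Site (F.P p.K) 0)) (ω : MultiCfg (F.P p.K) (SU N) V) : ℝ :=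
  (if S ⊆ Y then 1 else 0) * chiSmallAW F N V ν A₁ p g j (cubesIn (cubeχ F ν p g j) (Y \ S)) ω *
    chiLargeAW F N V ν A₁ p g j (cubesIn (cubeχ F ν p g j) S) ω * chiPrimeW F N V ν A₁ p g j (cubesIn (cubeχ F ν p g j) S) ω

/-- **THE 𝐓-WEIGHTS OF RECORD of the run `p` along the coupling history `g`** — 11a's datum `TkWeights F N V p.K` with `ζ` and `chiA` PINNED (§2, §4) and
`quad` the residual's. [cite: Balaban1988Convergent, (2.21) p.258, (3.21) p.269, (3.23) p.270] -/
def tkWeightsOfRecord (Z : TkResidualW F N V p.K) : TkWeights F N V p.K where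
  ζ := zetaWt F N V ν cR p g Z
  quad := Z.quad
  chiA := chiAW F N V ν A₁ p g

variable {F N V ν A₁ cR p g}

/-- Unfolding of the `ζ`-field (`rfl`). [cite: Balaban1988Convergent, (2.21) p.258 (bookkeeping)] -/
@[simp] theorem tkWeightsOfRecord_ζ (Z : TkResidualW F N V p.K) : (tkWeightsOfRecord F N V ν A₁ cR p g Z).ζ = zetaWt F N V ν cR p g Z := rfl

/-- Unfolding of the `quad`-field (`rfl`). [cite: Balaban1988Convergent, (2.21) p.258 (bookkeeping)] -/
@[simp] theorem tkWeightsOfRecord_quad (Z : TkResidualW F N V p.K) : (tkWeightsOfRecord F N V ν A₁ cR p g Z).quad = Z.quad := rfl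

/-- Unfolding of the `chiA`-field (`rfl`). [cite: Balaban1988Convergent, (3.21) p.269 (bookkeeping)] -/
@[simp] theorem tkWeightsOfRecord_chiA (Z : TkResidualW F N V p.K) : (tkWeightsOfRecord F N V ν A₁ cR p g Z).chiA = chiAW F N V ν A₁ p g := rfl

omit [SeminormedAddCommGroup V] in
/-- `0 ≤ ζ_j(Y)` of record under the residual law. [cite: Balaban1988Convergent, (2.21) p.258 (bookkeeping)] -/
theorem zetaWt_nonneg {Z : TkResidualW F N V p.K} (hZ : Z.Laws) (j : ℕ) (Y : Set (Site (F.P p.K) 0)) (ω : MultiCfg (F.P p.K) (SU N) V) :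
    0 ≤ zetaWt F N V ν cR p g Z j Y ω :=
  mul_nonneg (hZ.zeta0_nonneg j Y ω) (chiRegW_nonneg Y ω)

/-- `0 ≤ χ(Y, S)` of record. [cite: Balaban1988Convergent, (3.21) p.269 (bookkeeping)] -/
theorem chiAW_nonneg (j : ℕ) (Y S : Set (Site (F.P p.K) 0)) (ω : MultiCfg (F.P p.K) (SU N) V) : 0 ≤ chiAW F N V ν A₁ p g j Y S ω := by
  unfold chiAW
  split_ifs
  · simpa only [one_mul] using
      mul_nonneg (mul_nonneg (chiSmallAW_nonneg _ _) (chiLargeAW_nonneg _ _)) (chiPrimeW_nonneg _ _)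
  · simp

/-- `χ(Y, S) ≤ 1` of record (a product of factors in `[0, 1]`). [cite: Balaban1988Convergent, (3.21) p.269 (bookkeeping)] -/
theorem chiAW_le_one (j : ℕ) (Y S : Set (Site (F.P p.K) 0)) (ω : MultiCfg (F.P p.K) (SU N) V) : chiAW F N V ν A₁ p g j Y S ω ≤ 1 := by
  unfold chiAW
  split_ifs
  · simpa only [one_mul] using
      mul_le_one₀ (mul_le_one₀ (chiSmallAW_le_one _ _) (chiLargeAW_nonneg _ _) (chiLargeAW_le_one _ _))
        (chiPrimeW_nonneg _ _) (chiPrimeW_le_one _ _)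
  · simp

/-- **11a's DISPLAYED LAWS HOLD AT THE WEIGHTS OF RECORD** under the residual law (`ζ ≥ 0`, `0 ≤ χ ≤ 1` — PROVED; so every face of 11a ∕ 11c ∕ 11d stated
under `TkWeights.Laws` applies to the weights of record). [cite: Balaban1988Convergent, (2.21) p.258] -/
theorem tkWeightsOfRecord_laws {Z : TkResidualW F N V p.K} (hZ : Z.Laws) : (tkWeightsOfRecord F N V ν A₁ cR p g Z).Laws where
  zeta_nonneg := zetaWt_nonneg hZ
  chiA_nonneg := chiAW_nonneg
  chiA_le_one := chiAW_le_one

end Weights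

/-! ## §5  Support readings (the point of the pin) and the junction with def-R's support of record -/

section Support

variable {F : T4Family} {N : ℕ} [NeZero N] {V : Type} [SeminormedAddCommGroup V]
variable {ν : Stage7Numerics} {A₁ cR : ℝ} {p : B12.RunParams} {g : ℕ → ℝ}

omit [SeminormedAddCommGroup V] in
/-- **A NON-ZERO `ζ_j(Y)` OF RECORD FORCES p. 256's REGULARITY** of the retained scale-`j` variables on `Y`. [cite: Balaban1988Convergent, (2.10) p.256] -/
theorem zetaWt_ne_zero {Z : TkResidualW F N V p.K} {j : ℕ} {Y : Set (Site (F.P p.K) 0)} {ω : MultiCfg (F.P p.K) (SU N) V}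
    (h : zetaWt F N V ν cR p g Z j Y ω ≠ 0) : PlaqSmallOn (plaqsOf (pts j Y)) (cR * epsOfRecord ν g j) (ω j).1 :=
  (chiRegW_ne_zero_iff Y ω).1 (right_ne_zero_of_mul h)

/-- The region of (2.2) whose `j`-points form `Γ_j({Ω_i})` lies in `Ω^c_{j+1}` below the top scale: `Γ₀ = Ω₁ᶜ`, `Γ_j = Ω_j∖Ω_{j+1} ⊆ Ω^c_{j+1}`.
[cite: Balaban1988Convergent, (2.2) p.255] -/
theorem gammaRegion_subset_compl (Ω : ℕ → Set (Site (F.P p.K) 0)) {n j : ℕ} (hj : j < n) : gammaRegion Ω n j ⊆ (Ω (j + 1))ᶜ := by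
  unfold gammaRegion
  rw [if_neg (not_lt.mpr hj.le), if_neg (Nat.ne_of_lt hj)]
  split_ifs with h0
  · subst h0; exact subset_rfl
  · exact fun _ hx => hx.2

/-- … hence `Γ_j({Ω_i}) ⊆ (Ω^c_{j+1})^{(j)}` for `j < n` (r12's determining set `genSet`, `pts` = preimage under `embIter`).
[cite: Balaban1988Convergent, (2.2) p.255] -/
theorem genSet_subset_pts_compl (Ω : ℕ → Set (Site (F.P p.K) 0)) {n j : ℕ} (hj : j < n) : genSet Ω n j ⊆ pts j (Ω (j + 1))ᶜ :=
  fun _ hy => gammaRegion_subset_compl Ω hj hy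

/-- Regularity on a larger site set gives regularity on a smaller one (`plaqsOf` is monotone). [cite: Balaban1985RegularSpaces, p.77 (bookkeeping)] -/
theorem plaqSmallOn_plaqsOf_mono {j : ℕ} {S T : Set (Site (F.P p.K) j)} (hST : S ⊆ T) {δ : ℝ} {U : GaugeField (F.P p.K) j (SU N)}
    (h : PlaqSmallOn (plaqsOf T) δ U) : PlaqSmallOn (plaqsOf S) δ U :=
  fun q hq => h q (plaqsOf_mono hST hq)

/-- **THE T-HALF OF THE JOINT STATEMENT** (def-R [RFACE-11d]): along a sequence `{Ω_i}_{i ≤ n}`, if the generation-`j` weight `ζ_j(Ω^c_{j+1})` OF RECORD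
(`j < n`) does not vanish at `ω`, then `W j := (ω j).1` satisfies def-R's `regSuppOfRecord` clause AT SCALE `j` VERBATIM:
`PlaqSmallOn (plaqsOf (genSet Ω n j)) (cR·ε_j) (ω j).1`.  (The top scale `j = n` is the density's argument, restricted by the front factor `χ_n(Ω_n)` of
(2.17), not by a 𝐓-generation.) [cite: Balaban1988Convergent, (2.10) p.256, (2.2) p.255, (2.21) p.258] -/
theorem plaqSmallOn_genSet_of_zeta_ne_zero {Z : TkResidualW F N V p.K} (Ω : ℕ → Set (Site (F.P p.K) 0)) {n j : ℕ} (hj : j < n)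
    {ω : MultiCfg (F.P p.K) (SU N) V} (h : (tkWeightsOfRecord F N V ν A₁ cR p g Z).ζ j (Ω (j + 1))ᶜ ω ≠ 0) :
    PlaqSmallOn (plaqsOf (genSet Ω n j)) (cR * epsOfRecord ν g j) (ω j).1 :=
  plaqSmallOn_plaqsOf_mono (genSet_subset_pts_compl Ω hj) (zetaWt_ne_zero h)

/-- **A NON-ZERO `χ(Y, S)` OF RECORD FORCES**: `S ⊆ Y`; the small-fluctuation condition `|A_j(b)| < δ_j` on the bonds of every χ_{j+1}-cube inside
`Y∖S`; on every χ_{j+1}-cube inside `S` its failure (a bond with `|A_j(b)| ≥ δ_j`) and the (3.3) condition. [cite: Balaban1988Convergent, (3.16) p.268, (3.21) p.269, (3.3) p.265] -/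
theorem chiAW_ne_zero {j : ℕ} {Y S : Set (Site (F.P p.K) 0)} {ω : MultiCfg (F.P p.K) (SU N) V} (h : chiAW F N V ν A₁ p g j Y S ω ≠ 0) :
    S ⊆ Y ∧
      (∀ c ∈ cubesIn (cubeχ F ν p g j) (Y \ S), SmallFluct (bondsStarW F ν p g j) (ω j).2 (deltaOfRecord ν g j A₁) c) ∧
      (∀ c ∈ cubesIn (cubeχ F ν p g j) S, ¬ SmallFluct (bondsStarW F ν p g j) (ω j).2 (deltaOfRecord ν g j A₁) c) ∧
      (∀ c ∈ cubesIn (cubeχ F ν p g j) S,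
        SmallApproxFluct (sect3DataW F N ν p g j) (avOfRecord F N p.K) (2 * deltaOfRecord ν g j A₁) (ω j).1 (ω (j + 1)).1 c) := by
  classical
  unfold chiAW at h
  have h1 := left_ne_zero_of_mul (left_ne_zero_of_mul (left_ne_zero_of_mul h))
  have h2 := right_ne_zero_of_mul (left_ne_zero_of_mul (left_ne_zero_of_mul h))
  have h3 := right_ne_zero_of_mul (left_ne_zero_of_mul h)
  have h4 := right_ne_zero_of_mul h
  refine ⟨?_, ?_, ?_, ?_⟩
  · by_contra hSY; exact h1 (if_neg hSY)
  · rw [chiSmallAW_eq_ite] at h2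
    by_contra hc; exact h2 (if_neg hc)
  · rw [chiLargeAW_eq_ite] at h3
    by_contra hc; exact h3 (if_neg hc)
  · rw [chiPrimeW_eq_ite] at h4
    by_contra hc; exact h4 (if_neg hc)

/-- On a large-fluctuation cube of record there IS a bond with `δ_j ≤ |A_j(b)|` (r11's `not_smallFluct_iff`). [cite: Balaban1988Convergent, (3.16) p.268] -/
theorem exists_large_bond_of_chiAW_ne_zero {j : ℕ} {Y S : Set (Site (F.P p.K) 0)} {ω : MultiCfg (F.P p.K) (SU N) V}
    (h : chiAW F N V ν A₁ p g j Y S ω ≠ 0) {c : Iχ F ν p g j} (hc : c ∈ cubesIn (cubeχ F ν p g j) S) :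
    ∃ b ∈ bondsStarW F ν p g j c, deltaOfRecord ν g j A₁ ≤ ‖(ω j).2 b‖ :=
  (not_smallFluct_iff _ _ _ c).1 ((chiAW_ne_zero h).2.2.1 c hc)

/-- **THE A-WEIGHT OF RECORD IS SUPPORTED WHERE `χ(Y, S)` IS**: 11a's `TkWeights.w = χ · exp(−½·quad)` vanishes exactly where `χ` does.
[cite: Balaban1988Convergent, (2.21) p.258 (bookkeeping)] -/
theorem w_tkWeightsOfRecord_ne_zero_iff (Z : TkResidualW F N V p.K) (j : ℕ) (Λ' Y S : Set (Site (F.P p.K) 0)) (ω : MultiCfg (F.P p.K) (SU N) V) :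
    (tkWeightsOfRecord F N V ν A₁ cR p g Z).w j Λ' Y S ω ≠ 0 ↔ chiAW F N V ν A₁ p g j Y S ω ≠ 0 := by
  unfold TkWeights.w
  simp only [tkWeightsOfRecord_chiA, ne_eq, mul_eq_zero, Real.exp_ne_zero, or_false]

/-- THE LOCATED JUNK CORNER OF THE LETTER `A₁` (the sign of `δ_j`): for `δ_j ≤ 0` no cube with a bond is small-field, so a non-zero `χ(Y, S)` of
record forces every χ_{j+1}-cube inside `Y∖S` to have an EMPTY bond set `(□′^{∼2})^{(j)*}` — the weights then do not read `A_j` there.  Print's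
`δ_k = g_kA₁∕(A₀p₀(g_k))` is positive. [cite: Balaban1988Convergent, (3.4) p.265 (bookkeeping)] -/
theorem bondsStarW_eq_empty_of_chiAW_ne_zero_of_nonpos {j : ℕ} (hδ : deltaOfRecord ν g j A₁ ≤ 0) {Y S : Set (Site (F.P p.K) 0)}
    {ω : MultiCfg (F.P p.K) (SU N) V} (h : chiAW F N V ν A₁ p g j Y S ω ≠ 0) {c : Iχ F ν p g j}
    (hc : c ∈ cubesIn (cubeχ F ν p g j) (Y \ S)) : bondsStarW F ν p g j c = ∅ := by
  rcases Finset.eq_empty_or_nonempty (bondsStarW F ν p g j c) with he | ⟨b, hb⟩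
  · exact he
  · exact absurd ((chiAW_ne_zero h).2.1 c hc b hb) (not_lt.mpr (hδ.trans (norm_nonneg _)))

/-- `δ_j > 0` at print's signs: `0 < g_j`, `0 < A₁`, `0 < A₀p₀(g_j)`. [cite: Balaban1988Convergent, (3.4) p.265 (bookkeeping)] -/
theorem deltaOfRecord_pos {j : ℕ} (hg : 0 < g j) (hA₁ : 0 < A₁) (hp : 0 < p0Profile ν.A₀ ν.p₀ (g j)) : 0 < deltaOfRecord ν g j A₁ := by
  unfold deltaOfRecord
  exact div_pos (mul_pos hg hA₁) hp

end Support

end Literature.MathematicalPhysics.QuantumFieldTheory.Balaban1983to89.Node00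

end
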